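import Mathlib
import Summits.NavierStokesRegularity.NavierStokesRegularity.Theorems.TaoLadderRungThreeRestartControl
import Summits.NavierStokesRegularity.NavierStokesRegularity.Theses.CompletionRelayChain
import HarnessLib

/-!
# `CompletionRelayChain.RestartControl` (item stmt-NavierStokesRegularity-24852; host support)

The support `RestartControl` of route `CompletionRelayChain` is, character for character, the
shared support `RestartControl` of routes `TaoLadderRungThree` / `HeteroclinicTriggerChain` /
`TrappingWindowRungThree` (items stmt-NavierStokesRegularity-20424 / 21750), already proved in
the tree as `Theorems.RestartControl.main` (file `TaoLadderRungThreeRestartControl.lean`):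
restarted windows of a Theorem-4.2-level pseudo-solution at an epoch checkpoint are
`(η, η)`-pseudo-flows with admissible slack once `n₀ ≥ N₀(K₁, K₂)`. This file closes the new
item by that theorem.

HONEST FRAMING: definitional bookkeeping about Tao-type MODEL lattice pseudo-flows (Tao 2016 §6);
nothing here is a statement about the Navier–Stokes equations, and the route's rung leaf
(`TaoLadderRungThree.TargetR64`, TL-M3-R64) is not the summit Statement.
-/

noncomputable section

set_option linter.dupNamespace false

namespace Summit.NavierStokesRegularity.NavierStokesRegularity.Theorems

open RestartControl in
/-- **Item stmt-NavierStokesRegularity-24852** (`CompletionRelayChain.RestartControl`): Tao's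
scale covariance at a checkpoint with small defects and admissible slack, closed by the tree
theorem `RestartControl.main`. [cite: Tao2016AveragedNS, §6.4 Prop. 6.5 and Lemma 6.7] -/
theorem completionRelayChain_restartControl_proof :
    Summit.NavierStokesRegularity.NavierStokesRegularity.Theses.CompletionRelayChain.RestartControl := by
  unfold Summit.NavierStokesRegularity.NavierStokesRegularity.Theses.CompletionRelayChain.RestartControl
  intro ε₀ θ c η i₀ α X₀ P env K₁ K₂ hε₀ hθ hc hη hX₀ hK₁ hK₂
  exact main hε₀ hθ hc hη hX₀ hK₁ hK₂

end Summit.NavierStokesRegularity.NavierStokesRegularity.Theorems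

end
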